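import Summits.HubbardSuperconductivity.HubbardSuperconductivity.Theorems.AnisotropyChordSpinMonotoneTwoMagnonGramTP
import Summits.HubbardSuperconductivity.HubbardSuperconductivity.Theorems.AnisotropyChordSpinMonotoneTPosDefs

/-!
# Route `AnisotropyChord`: the two-magnon, one-contact-orbit SLICES of the typed conjectures TP-VT and
# (OM) are THEOREMS (discharged by `TwoMagnon.twoMagnon_gramTP2_of_edgeTransitive`)

`…SpinMonotoneDefs` types the theory seat's cycle-6 conjectures `VertexTransitiveGroundStateGramTP2`
(TP-VT) and `VertexTransitiveOverlapMonotone` (OM) over all sectors of all connected vertex-transitive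
graphs.  This file records, in exactly their binder shape, that the sector `S^z_tot = |V|/2 − 2` of
every connected vertex- AND EDGE-transitive graph satisfies them (indeed without the lower bound
`−1 ≤ Δ`): `twoMagnonGramTP2_slice_of_edgeTransitive`, `twoMagnonOverlapMonotone_slice_of_edgeTransitive`,
and the same in the `IsSectorGroundState` currency of `…SpinMonotoneTPosDefs`
(`twoMagnon_gramTP2_of_isSectorGroundState`, `twoMagnon_overlapMonotone_of_isSectorGroundState`,
`twoMagnon_gramTP2_01_slice_of_edgeTransitive`).  NOT claimed: fidelity SUPERMODULARITY (TPos-VT)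
in this class — it is a different (additive) statement.  No definition is introduced.
-/

set_option linter.dupNamespace false

noncomputable section

namespace Summit.HubbardSuperconductivity.HubbardSuperconductivity.Theorems.AnisotropyChord

open Matrix Complex Finset
open Literature.MathematicalPhysics.QuantumLattice Literature.Probability.LatticeModels
open Literature.Combinatorics.SimpleGraph (IsVertexTransitive)
open Literature.Combinatorics.SimpleGraph.LovaszThetaEdgeTransitive (IsEdgeTransitive)

/-- **The two-magnon edge-transitive slice of TP-VT is a theorem**: the body of
`VertexTransitiveGroundStateGramTP2` at `M = |V|/2 − 2`, under the extra hypothesis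
`IsEdgeTransitive G` (all square tori, cycles, hypercubes, `K_n`, `K_{m,m}`, …). [folklore] -/
theorem twoMagnonGramTP2_slice_of_edgeTransitive :
    ∀ (V : Type) [Fintype V] [DecidableEq V] (G : SimpleGraph V) [DecidableRel G.Adj],
      G.Connected → IsVertexTransitive G → IsEdgeTransitive G → ∀ (Δ₁ Δ₂ Δ₃ Δ₄ : ℝ),
      -1 ≤ Δ₁ → Δ₁ ≤ Δ₂ → Δ₂ ≤ 1 → -1 ≤ Δ₃ → Δ₃ ≤ Δ₄ → Δ₄ ≤ 1 →
      ∀ ψ₁ ψ₂ ψ₃ ψ₄ : TensorIndex V 2 → ℂ,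
        ψ₁ ∈ spinZSector (Λ := V) 1 ((Fintype.card V : ℝ) / 2 - 2) → star ψ₁ ⬝ᵥ ψ₁ = 1 →
        xxzHamiltonian 1 G (-1) Δ₁ *ᵥ ψ₁ =
          ((lowestEnergyInSector 1 (xxzHamiltonian 1 G (-1) Δ₁) ((Fintype.card V : ℝ) / 2 - 2) : ℝ) : ℂ) • ψ₁ →
        ψ₂ ∈ spinZSector (Λ := V) 1 ((Fintype.card V : ℝ) / 2 - 2) → star ψ₂ ⬝ᵥ ψ₂ = 1 →
        xxzHamiltonian 1 G (-1) Δ₂ *ᵥ ψ₂ =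
          ((lowestEnergyInSector 1 (xxzHamiltonian 1 G (-1) Δ₂) ((Fintype.card V : ℝ) / 2 - 2) : ℝ) : ℂ) • ψ₂ →
        ψ₃ ∈ spinZSector (Λ := V) 1 ((Fintype.card V : ℝ) / 2 - 2) → star ψ₃ ⬝ᵥ ψ₃ = 1 →
        xxzHamiltonian 1 G (-1) Δ₃ *ᵥ ψ₃ =
          ((lowestEnergyInSector 1 (xxzHamiltonian 1 G (-1) Δ₃) ((Fintype.card V : ℝ) / 2 - 2) : ℝ) : ℂ) • ψ₃ →
        ψ₄ ∈ spinZSector (Λ := V) 1 ((Fintype.card V : ℝ) / 2 - 2) → star ψ₄ ⬝ᵥ ψ₄ = 1 →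
        xxzHamiltonian 1 G (-1) Δ₄ *ᵥ ψ₄ =
          ((lowestEnergyInSector 1 (xxzHamiltonian 1 G (-1) Δ₄) ((Fintype.card V : ℝ) / 2 - 2) : ℝ) : ℂ) • ψ₄ →
        ‖star ψ₁ ⬝ᵥ ψ₄‖ * ‖star ψ₂ ⬝ᵥ ψ₃‖ ≤ ‖star ψ₁ ⬝ᵥ ψ₃‖ * ‖star ψ₂ ⬝ᵥ ψ₄‖ :=
  fun _ _ _ G _ hG hVT hET _ _ _ _ _ h12 h2 _ h34 h4 _ _ _ _ g₁m g₁n g₁e g₂m g₂n g₂e g₃m g₃n g₃e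
      g₄m g₄n g₄e =>
    TwoMagnon.twoMagnon_gramTP2_of_edgeTransitive G hG hVT hET h12 h2 h34 h4
      g₁m g₁n g₁e g₂m g₂n g₂e g₃m g₃n g₃e g₄m g₄n g₄e

/-- **The two-magnon edge-transitive slice of (OM) is a theorem**: the body of
`VertexTransitiveOverlapMonotone` at `M = |V|/2 − 2` under `IsEdgeTransitive G`. [folklore] -/
theorem twoMagnonOverlapMonotone_slice_of_edgeTransitive :
    ∀ (V : Type) [Fintype V] [DecidableEq V] (G : SimpleGraph V) [DecidableRel G.Adj],
      G.Connected → IsVertexTransitive G → IsEdgeTransitive G → ∀ (Δ₁ Δ₁' Δ₂ : ℝ),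
      -1 ≤ Δ₁ → Δ₁ ≤ Δ₁' → Δ₁' ≤ Δ₂ → Δ₂ ≤ 1 →
      ∀ ψ₁ ψ₁' φ : TensorIndex V 2 → ℂ,
        ψ₁ ∈ spinZSector (Λ := V) 1 ((Fintype.card V : ℝ) / 2 - 2) → star ψ₁ ⬝ᵥ ψ₁ = 1 →
        xxzHamiltonian 1 G (-1) Δ₁ *ᵥ ψ₁ =
          ((lowestEnergyInSector 1 (xxzHamiltonian 1 G (-1) Δ₁) ((Fintype.card V : ℝ) / 2 - 2) : ℝ) : ℂ) • ψ₁ →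
        ψ₁' ∈ spinZSector (Λ := V) 1 ((Fintype.card V : ℝ) / 2 - 2) → star ψ₁' ⬝ᵥ ψ₁' = 1 →
        xxzHamiltonian 1 G (-1) Δ₁' *ᵥ ψ₁' =
          ((lowestEnergyInSector 1 (xxzHamiltonian 1 G (-1) Δ₁') ((Fintype.card V : ℝ) / 2 - 2) : ℝ) : ℂ) • ψ₁' →
        φ ∈ spinZSector (Λ := V) 1 ((Fintype.card V : ℝ) / 2 - 2) → star φ ⬝ᵥ φ = 1 →
        xxzHamiltonian 1 G (-1) Δ₂ *ᵥ φ =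
          ((lowestEnergyInSector 1 (xxzHamiltonian 1 G (-1) Δ₂) ((Fintype.card V : ℝ) / 2 - 2) : ℝ) : ℂ) • φ →
        ‖star ψ₁ ⬝ᵥ φ‖ ≤ ‖star ψ₁' ⬝ᵥ φ‖ :=
  fun _ _ _ G _ hG hVT hET _ _ _ _ h1 h2 h3 _ _ _ g₁m g₁n g₁e g₂m g₂n g₂e g₃m g₃n g₃e =>
    TwoMagnon.twoMagnon_overlapMonotone_of_edgeTransitive G hG hVT hET h1 h2 h3
      g₁m g₁n g₁e g₂m g₂n g₂e g₃m g₃n g₃e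

/-- TP₂ of the two-magnon ground-state Gram kernel on edge-transitive graphs in the
`IsSectorGroundState` currency, all `Δ ≤ 1` (no window). [folklore] -/
theorem twoMagnon_gramTP2_of_isSectorGroundState {V : Type} [Fintype V] [DecidableEq V]
    (G : SimpleGraph V) [DecidableRel G.Adj] (hG : G.Connected) (hVT : IsVertexTransitive G)
    (hET : IsEdgeTransitive G) {Δ₁ Δ₂ Δ₃ Δ₄ : ℝ} (h12 : Δ₁ ≤ Δ₂) (h2 : Δ₂ ≤ 1) (h34 : Δ₃ ≤ Δ₄)
    (h4 : Δ₄ ≤ 1) {ψ₁ ψ₂ ψ₃ ψ₄ : TensorIndex V 2 → ℂ}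
    (g₁ : IsSectorGroundState G Δ₁ ((Fintype.card V : ℝ) / 2 - 2) ψ₁)
    (g₂ : IsSectorGroundState G Δ₂ ((Fintype.card V : ℝ) / 2 - 2) ψ₂)
    (g₃ : IsSectorGroundState G Δ₃ ((Fintype.card V : ℝ) / 2 - 2) ψ₃)
    (g₄ : IsSectorGroundState G Δ₄ ((Fintype.card V : ℝ) / 2 - 2) ψ₄) :
    ‖star ψ₁ ⬝ᵥ ψ₄‖ * ‖star ψ₂ ⬝ᵥ ψ₃‖ ≤ ‖star ψ₁ ⬝ᵥ ψ₃‖ * ‖star ψ₂ ⬝ᵥ ψ₄‖ :=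
  TwoMagnon.twoMagnon_gramTP2_of_edgeTransitive G hG hVT hET h12 h2 h34 h4
    g₁.1 g₁.2.1 g₁.2.2 g₂.1 g₂.2.1 g₂.2.2 g₃.1 g₃.2.1 g₃.2.2 g₄.1 g₄.2.1 g₄.2.2

/-- (OM) for two magnons on edge-transitive graphs in the `IsSectorGroundState` currency, `Δ₂ ≤ 1`.
[folklore] -/
theorem twoMagnon_overlapMonotone_of_isSectorGroundState {V : Type} [Fintype V] [DecidableEq V]
    (G : SimpleGraph V) [DecidableRel G.Adj] (hG : G.Connected) (hVT : IsVertexTransitive G)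
    (hET : IsEdgeTransitive G) {Δ₁ Δ₁' Δ₂ : ℝ} (h1 : Δ₁ ≤ Δ₁') (h2 : Δ₁' ≤ Δ₂) (h3 : Δ₂ ≤ 1)
    {ψ₁ ψ₁' φ : TensorIndex V 2 → ℂ}
    (g₁ : IsSectorGroundState G Δ₁ ((Fintype.card V : ℝ) / 2 - 2) ψ₁)
    (g₁' : IsSectorGroundState G Δ₁' ((Fintype.card V : ℝ) / 2 - 2) ψ₁')
    (gφ : IsSectorGroundState G Δ₂ ((Fintype.card V : ℝ) / 2 - 2) φ) :
    ‖star ψ₁ ⬝ᵥ φ‖ ≤ ‖star ψ₁' ⬝ᵥ φ‖ :=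
  TwoMagnon.twoMagnon_overlapMonotone_of_edgeTransitive G hG hVT hET h1 h2 h3
    g₁.1 g₁.2.1 g₁.2.2 g₁'.1 g₁'.2.1 g₁'.2.2 gφ.1 gφ.2.1 gφ.2.2

/-- **Fidelity supermodularity's TP₂ CONSEQUENCE holds window-free in the two-magnon edge-transitive
class**: the conclusion of `gramTP2_01_of_fidelitySupermodular` (TP-VT on `[0,1]`) restricted to
`M = |V|/2 − 2` and edge-transitive `G` is unconditional. [folklore] -/
theorem twoMagnon_gramTP2_01_slice_of_edgeTransitive {V : Type} [Fintype V] [DecidableEq V]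
    (G : SimpleGraph V) [DecidableRel G.Adj] (hG : G.Connected) (hVT : IsVertexTransitive G)
    (hET : IsEdgeTransitive G) {Δ₁ Δ₂ Δ₃ Δ₄ : ℝ} (_h1 : 0 ≤ Δ₁) (h12 : Δ₁ ≤ Δ₂) (h2 : Δ₂ ≤ 1)
    (_h3 : 0 ≤ Δ₃) (h34 : Δ₃ ≤ Δ₄) (h4 : Δ₄ ≤ 1) {ψ₁ ψ₂ ψ₃ ψ₄ : TensorIndex V 2 → ℂ}
    (g₁ : IsSectorGroundState G Δ₁ ((Fintype.card V : ℝ) / 2 - 2) ψ₁)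
    (g₂ : IsSectorGroundState G Δ₂ ((Fintype.card V : ℝ) / 2 - 2) ψ₂)
    (g₃ : IsSectorGroundState G Δ₃ ((Fintype.card V : ℝ) / 2 - 2) ψ₃)
    (g₄ : IsSectorGroundState G Δ₄ ((Fintype.card V : ℝ) / 2 - 2) ψ₄) :
    ‖star ψ₁ ⬝ᵥ ψ₄‖ * ‖star ψ₂ ⬝ᵥ ψ₃‖ ≤ ‖star ψ₁ ⬝ᵥ ψ₃‖ * ‖star ψ₂ ⬝ᵥ ψ₄‖ :=
  twoMagnon_gramTP2_of_isSectorGroundState G hG hVT hET h12 h2 h34 h4 g₁ g₂ g₃ g₄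

end Summit.HubbardSuperconductivity.HubbardSuperconductivity.Theorems.AnisotropyChord
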